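import Mathlib.Data.Fintype.BigOperators
import Mathlib.RingTheory.MvPolynomial.WeightedHomogeneous
import Literature.Computability.AlgebraicComplexity.LRPencilOfMatrix
import Summits.ValiantsHypothesis.ValiantsHypothesis.Theorems.RigidMinimalRepsMinimalRepTorusSymmetricStubInitialForm

/-!
# Crux `FreeSubtorus.OrbitDimensionBound` (stmt-ValiantsHypothesis-16133), line `Sketch` —
# stub `stub_initialFormAccumulates`: the initial form along ONE cocharacter

Let `A` be an `m × m` matrix of affine linear forms in the variables `x_{kl}` (`k, l : Fin n`) with
`det A = per_n`, let `μ : Fin n ⊕ Fin n → ℤ` be a cocharacter of the two-sided torus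
`T' = (ℂˣ)ⁿ × (ℂˣ)ⁿ`, and let `a, b : Fin m → ℤ` be a SUB-POTENTIAL for `A` along `μ`: a constant sits
at `(i,j)` only if `a i + b j ≤ 0`, the variable `x_{kl}` only if `a i + b j ≤ μ(inl k) + μ(inr l)`,
and `Σ a + Σ b = Σ_q μ q` (the `μ`-weight of every monomial of `per_n`).  Then the INITIAL FORM
`A⁰ i j :=` (the `μ`-weight-`(a i + b j)` component of `A i j`) is again an affine determinantal
representation of `per_n` of the same size, its supports sit inside those of `A`, and it is `μ`-TIGHT
(every constant of `A⁰` at `(i,j)` has `a i + b j = 0`, every variable `x_{kl}` of `A⁰` at `(i,j)` has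
`a i + b j = μ(inl k) + μ(inr l)`).

Proof.  This is the SCALAR instance (weights in `ℤ`) of the landed lattice-valued initial-form
identity of `RigidMinimalRepsMinimalRepTorusSymmetricStubInitialForm`: grade `ℂ[x]` by
`w (k,l) = μ(inl k) + μ(inr l) ∈ ℤ`; affine entries and the two sub-potential hypotheses say that
every monomial of `A i j` has weight `≥ a i + b j`
(`InitialForm.le_weight_of_totalDegree_le_one`), so the weight-`(Σ a + Σ b)` component of `det A` is
`det A⁰` (`InitialForm.weightedHomogeneousComponent_det_of_le`, any ordered abelian group of
weights); and `per_n = Σ_π Π_i x_{π i, i}` is weighted-homogeneous of weight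
`Σ_i (μ(inl (π i)) + μ(inr i)) = Σ_k μ(inl k) + Σ_l μ(inr l) = Σ_q μ q`, so
`det A⁰ = (per_n)_{Σ μ} = per_n`.  (Białynicki-Birula limit of the gauge class of `A` along `μ`.)

Helper file for the crux (`--supports`); it closes nothing by itself.  Deliberately NOT here: the
lattice-tightness bookkeeping (stub `stub_tightModLatticeLifts`) and the existence of a small
lattice-tight face (stub `stub_smallFace`), which are other files of the line.
-/

-- `Summit.ValiantsHypothesis.ValiantsHypothesis.…` is the tree's mandated single-conjunct layout
-- (Sub = Summit), so the duplicated namespace component is intended.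
set_option linter.dupNamespace false

noncomputable section

namespace Summit.ValiantsHypothesis.ValiantsHypothesis.Theorems.FreeSubtorusOrbitDimensionBound

open Matrix MvPolynomial Finset
open Literature.Computability.AlgebraicComplexity LRPencil
open Summit.ValiantsHypothesis.ValiantsHypothesis.Theorems.RigidMinimalRepsMinimalRepTorusSymmetric

/-- **The permanent is `μ`-homogeneous of weight `Σ_q μ q`.** For the scalar grading
`w (k, l) = μ(inl k) + μ(inr l)` of the `n²` variables induced by a cocharacter
`μ : Fin n ⊕ Fin n → ℤ` of the two-sided torus, `per_n = Σ_π Π_i x_{π i, i}` is weighted-homogeneous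
of weight `Σ_i (μ(inl (π i)) + μ(inr i)) = Σ_k μ(inl k) + Σ_l μ(inr l) = Σ_q μ q`. [folklore] -/
theorem perPoly_isWeightedHomogeneous_cocharacter (n : ℕ) (μ : Fin n ⊕ Fin n → ℤ)
    (w : Fin n × Fin n → ℤ) (hw : ∀ p, w p = μ (Sum.inl p.1) + μ (Sum.inr p.2)) :
    IsWeightedHomogeneous w (perPoly (Fin n) ℂ) (∑ q, μ q) := by
  unfold perPoly Matrix.permanent
  refine IsWeightedHomogeneous.sum _ _ _ fun π _ => ?_
  have h := IsWeightedHomogeneous.prod Finset.univ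
    (fun i : Fin n => Matrix.mvPolynomialX (Fin n) (Fin n) ℂ (π i) i) (fun i => w (π i, i))
    fun i _ => by simpa [Matrix.mvPolynomialX] using isWeightedHomogeneous_X ℂ w (π i, i)
  have e1 : ∑ i, μ (Sum.inl (π i)) = ∑ k, μ (Sum.inl k) :=
    Fintype.sum_equiv π _ _ fun _ => rfl
  have h1 : ∑ i, w (π i, i) = ∑ q, μ q := by
    simp only [hw]
    rw [Finset.sum_add_distrib, e1, Fintype.sum_sum_type]
  rw [h1] at h
  exact h

/-- Registered stub **`stub_initialFormAccumulates`** of the line `Sketch` on the crux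
`FreeSubtorus.OrbitDimensionBound`: **the initial form of an affine determinantal representation of
`per_n` along ONE cocharacter with a sub-potential is again an affine determinantal representation of
`per_n`, of the same size, with supports inside the original ones, and tight for that cocharacter.**
Given `A` affine with `det A = per_n`, a cocharacter `μ : Fin n ⊕ Fin n → ℤ` and potentials
`a, b : Fin m → ℤ` with `Λ_{ij} ≠ 0 ⇒ a i + b j ≤ 0`, `(A_{kl})_{ij} ≠ 0 ⇒ a i + b j ≤ μ(inl k) + μ(inr l)`
and `Σ a + Σ b = Σ_q μ q`, the matrix `A⁰ i j :=` (weight-`(a i + b j)` component of `A i j`) for the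
grading `x_{kl} ↦ μ(inl k) + μ(inr l)` works: `det A⁰` is the weight-`(Σ μ)` component of
`det A = per_n`, which is `per_n` itself; supports shrink; constants of `A⁰` have weight
`0 = a i + b j` and its variables `x_{kl}` have weight `μ(inl k) + μ(inr l) = a i + b j`.
[cite: Bialynickibirula1973, Thm. 4.1] [cite: LandsbergRessayre2017, §3] -/
theorem stub_initialFormAccumulates :
    ∀ (n m : ℕ) (A : Matrix (Fin m) (Fin m) (MvPolynomial (Fin n × Fin n) ℂ))
    (μ : Fin n ⊕ Fin n → ℤ) (a b : Fin m → ℤ),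
    Literature.Computability.AlgebraicComplexity.IsAffineDetRepr
        (Literature.Computability.AlgebraicComplexity.perPoly (Fin n) ℂ) A →
    (∀ i j, Literature.Computability.AlgebraicComplexity.constPart A i j ≠ 0 → a i + b j ≤ 0) →
    (∀ i j (p : Fin n × Fin n),
      Literature.Computability.AlgebraicComplexity.LRPencil.coeffMat A p i j ≠ 0 →
      a i + b j ≤ μ (Sum.inl p.1) + μ (Sum.inr p.2)) →
    ∑ i, a i + ∑ j, b j = ∑ q, μ q →
    ∃ A' : Matrix (Fin m) (Fin m) (MvPolynomial (Fin n × Fin n) ℂ),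
      Literature.Computability.AlgebraicComplexity.IsAffineDetRepr
          (Literature.Computability.AlgebraicComplexity.perPoly (Fin n) ℂ) A' ∧
      (∀ i j, (A' i j).support ⊆ (A i j).support) ∧
      (∀ i j, Literature.Computability.AlgebraicComplexity.constPart A' i j ≠ 0 → a i + b j = 0) ∧
      (∀ i j (p : Fin n × Fin n),
        Literature.Computability.AlgebraicComplexity.LRPencil.coeffMat A' p i j ≠ 0 →
        a i + b j = μ (Sum.inl p.1) + μ (Sum.inr p.2)) := by
  intro n m A μ a b hA h0 h1 hsum
  -- the scalar grading induced by the cocharacter `μ`, kept opaque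
  obtain ⟨w, hw⟩ : ∃ w : Fin n × Fin n → ℤ, ∀ p, w p = μ (Sum.inl p.1) + μ (Sum.inr p.2) :=
    ⟨_, fun _ => rfl⟩
  -- every monomial of the affine entry `A i j` has weight `≥ a i + b j`
  have hle : ∀ i j d, coeff d (A i j) ≠ 0 → a i + b j ≤ Finsupp.weight w d := fun i j =>
    InitialForm.le_weight_of_totalDegree_le_one w (hA.1 i j)
      (fun h => h0 i j (by rwa [constPart_apply, constantCoeff_eq]))
      fun v h => by
        rw [hw]
        exact h1 i j v (by rwa [coeffMat_apply])
  refine ⟨Matrix.of fun i j => weightedHomogeneousComponent w (a i + b j) (A i j),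
    ⟨fun i j => ?_, ?_⟩, fun i j => ?_, fun i j hij => ?_, fun i j v hv => ?_⟩
  · -- affine entries: the support only shrinks
    rw [Matrix.of_apply]
    exact (totalDegree_le_of_support_subset
      (InitialForm.support_weightedHomogeneousComponent_subset w _ _)).trans (hA.1 i j)
  · -- `det A⁰ = (det A)_{Σ μ} = (per_n)_{Σ μ} = per_n`
    rw [← InitialForm.weightedHomogeneousComponent_det_of_le w A a b hle, hsum, hA.2]
    exact (perPoly_isWeightedHomogeneous_cocharacter n μ w hw).weightedHomogeneousComponent_same
  · rw [Matrix.of_apply]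
    exact InitialForm.support_weightedHomogeneousComponent_subset w _ _
  · -- tightness of the constants: weight `0 = a i + b j`
    rw [constPart_apply, Matrix.of_apply, constantCoeff_eq] at hij
    have h := weightedHomogeneousComponent_isWeightedHomogeneous (a i + b j) (A i j) hij
    rw [map_zero] at h
    exact h.symm
  · -- tightness of the variables: weight `μ(inl k) + μ(inr l) = a i + b j`
    rw [coeffMat_apply, Matrix.of_apply] at hv
    have h := weightedHomogeneousComponent_isWeightedHomogeneous (a i + b j) (A i j) hv
    rw [Finsupp.weight_single, one_smul, hw] at h
    exact h.symm

end Summit.ValiantsHypothesis.ValiantsHypothesis.Theorems.FreeSubtorusOrbitDimensionBound
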